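import Literature.Geometry.Symplectic.OrigamiMoserLinear
import Literature.Geometry.Symplectic.OrigamiFoldFirstOrderCalculus
import HarnessLib

/-!
# The origami Moser argument, III: the simple zero of the Pfaffian along the fold

Third file of the proof of the named fact `Literature.Geometry.Symplectic.exists_origamiCollarNormalForm`
(Cannas da Silva–Guillemin–Woodward 2000, Thm. 1).  For the segment `ω_s = (1-s) c^*ω + s ω₁`
between the collar form and the model form on `N × ℝ` the Moser vector `ι(X_s) ω_s = -μ` is
smooth across the zero section only if `Pf(ω_s)` has a SIMPLE zero there for every
`s ∈ [0, 1]` — the role of the orientation convention of Def. 2.2 of Cannas da Silva–Guillemin–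
Pires (first-order coefficient `B₁(X) > 0`, `OrigamiFoldFirstOrder(Sign).lean`).  This file reads
the `t`-derivative of the Pfaffian `pfF` (`OrigamiMoserLinear.lean`) along a curve of `2`-forms
on `ℝ³ × ℝ` through a form whose kernel contains `(0, 1)` and `(v, 0)`:

* `pfCoeff β₀ v` — the coefficient `-(det L)⁻¹ β₀(T e₀, T e₁)` of an adapted frame `T` of
  `OrigamiFoldFirstOrder.lean` (`exists_adaptedFrame`), non-zero when `β₀ ≠ 0`
  (`pfCoeff_ne_zero`);
* **`hasDerivAt_pfF_comp`** — if `C` is a curve of `2`-forms with `C 0 = β₀` as above and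
  derivative `C'` at `0`, then `d/dt|₀ pfF (C t) = pfCoeff β₀ v · C' ((0,1), (v,0))`
  (`hasDerivAt_pfaffCombination`: five of the six frame coefficients vanish at `t = 0`);
* `deriv_pfF_segment_ne_zero` — for two such curves `C₀, C₁` with `C₀ 0 = C₁ 0` and
  `C₀' ((0,1),(v,0))`, `C₁' ((0,1),(v,0))` both positive, the segment `(1-s) C₀ + s C₁` has
  `d/dt|₀ pfF ≠ 0` for every `s ∈ [0, 1]`.

Everything here is proved; no facts.

## References

* A. Cannas da Silva, V. Guillemin, C. Woodward, *On the unfolding of folded symplectic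
  structures*, Math. Res. Lett. 7 (2000), proof of Thm. 1. [CannasGuilleminWoodward2000]
* A. Cannas da Silva, V. Guillemin, A. R. Pires, *Symplectic Origami*, IMRN 2011 =
  arXiv:0909.4065, Def. 2.2 and proof of Prop. 2.8. [CannasdasilvaGuilleminPires2010]
-/

noncomputable section

open scoped Topology
open Set Function

namespace Literature.Geometry.Symplectic

namespace OrigamiMoser

local notation "E3" => EuclideanSpace ℝ (Fin 3)
local notation "E4" => EuclideanSpace ℝ (Fin 4)
local notation "F4" => EuclideanSpace ℝ (Fin 3) × ℝ

/-! ### The adapted frame and the first-order coefficient -/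

/-- A chosen frame of `ℝ³ × ℝ` adapted to `v ≠ 0`: `T e₂ = (v, 0)`, `T e₃ = (0, 1)`,
`T e₀, T e₁` horizontal (from `exists_adaptedFrame`; the identity frame read through `appendIso`
if `v = 0`, a junk value). [folklore] -/
def adaptedFrame (v : E3) : E4 →L[ℝ] F4 :=
  if hv : v ≠ 0 then Classical.choose (exists_adaptedFrame v hv) else (appendIso.symm : E4 →L[ℝ] F4)

/-- The properties of the adapted frame. [folklore] -/
theorem adaptedFrame_spec {v : E3} (hv : v ≠ 0) :
    Function.Bijective (adaptedFrame v) ∧ ((adaptedFrame v) (stdVec 0)).2 = 0 ∧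
      ((adaptedFrame v) (stdVec 1)).2 = 0 ∧ (adaptedFrame v) (stdVec 2) = (v, 0) ∧
        (adaptedFrame v) (stdVec 3) = (0, 1) := by
  rw [adaptedFrame, dif_pos hv]
  exact Classical.choose_spec (exists_adaptedFrame v hv)

/-- The adapted frame as an endomorphism of `ℝ³ × ℝ` (through `appendIso`). [folklore] -/
def adaptedEndo (v : E3) : F4 →L[ℝ] F4 := (adaptedFrame v).comp (appendIso : F4 →L[ℝ] E4)

/-- The determinant of the adapted endomorphism is non-zero. [folklore] -/
theorem det_adaptedEndo_ne_zero {v : E3} (hv : v ≠ 0) :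
    LinearMap.det (adaptedEndo v : F4 →ₗ[ℝ] F4) ≠ 0 := by
  have hbij : Function.Bijective (adaptedEndo v : F4 →ₗ[ℝ] F4) :=
    (adaptedFrame_spec hv).1.comp appendIso.bijective
  have h : (adaptedEndo v : F4 →ₗ[ℝ] F4) =
      (LinearEquiv.ofBijective (adaptedEndo v : F4 →ₗ[ℝ] F4) hbij : F4 →ₗ[ℝ] F4) := rfl
  rw [h]
  exact (LinearEquiv.isUnit_det' _).ne_zero

/-- **The Pfaffian in the adapted frame**: `pfF β = (det L)⁻¹ · (Pfaffian combination of the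
values of `β` on the frame `T e_k`)`. [folklore] -/
theorem pfF_eq_frame (β : F4 [⋀^Fin 2]→L[ℝ] ℝ) {v : E3} (hv : v ≠ 0) :
    pfF β = (LinearMap.det (adaptedEndo v : F4 →ₗ[ℝ] F4))⁻¹ *
      (β ![adaptedFrame v (stdVec 0), adaptedFrame v (stdVec 1)] *
          β ![adaptedFrame v (stdVec 2), adaptedFrame v (stdVec 3)] -
        β ![adaptedFrame v (stdVec 0), adaptedFrame v (stdVec 2)] *
          β ![adaptedFrame v (stdVec 1), adaptedFrame v (stdVec 3)] +
        β ![adaptedFrame v (stdVec 0), adaptedFrame v (stdVec 3)] *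
          β ![adaptedFrame v (stdVec 1), adaptedFrame v (stdVec 2)]) := by
  have h1 := pfF_compContinuousLinearMap β (adaptedEndo v)
  have h2 : pfF (β.compContinuousLinearMap (adaptedEndo v)) =
      pfaffian (β.compContinuousLinearMap (adaptedFrame v)) := by
    have h : toE4₂ (β.compContinuousLinearMap (adaptedEndo v)) =
        β.compContinuousLinearMap (adaptedFrame v) := by
      ext x
      simp only [toE4₂, ContinuousAlternatingMap.compContinuousLinearMap_apply, adaptedEndo]
      congr 1
      funext i
      simp
    rw [pfF, h]
  rw [h2, pfaffian_compContinuousLinearMap_eq] at h1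
  rw [eq_inv_mul_iff_mul_eq₀ (det_adaptedEndo_ne_zero hv)]
  exact h1.symm

/-- **The first-order coefficient** `-(det L)⁻¹ β₀(T e₀, T e₁)` of a `2`-form `β₀` at a
non-zero horizontal vector `v`. [folklore] -/
def pfCoeff (β₀ : F4 [⋀^Fin 2]→L[ℝ] ℝ) (v : E3) : ℝ :=
  -((LinearMap.det (adaptedEndo v : F4 →ₗ[ℝ] F4))⁻¹ *
    β₀ ![adaptedFrame v (stdVec 0), adaptedFrame v (stdVec 1)])

/-- A `2`-form on `ℝ⁴` vanishing on the six pairs of standard vectors is zero. [folklore] -/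
theorem alt_two_eq_zero_of_stdVec {α : E4 [⋀^Fin 2]→L[ℝ] ℝ}
    (h01 : α ![stdVec 0, stdVec 1] = 0) (h02 : α ![stdVec 0, stdVec 2] = 0)
    (h03 : α ![stdVec 0, stdVec 3] = 0) (h12 : α ![stdVec 1, stdVec 2] = 0)
    (h13 : α ![stdVec 1, stdVec 3] = 0) (h23 : α ![stdVec 2, stdVec 3] = 0) : α = 0 := by
  ext u
  have hu : u = ![u 0, u 1] := by
    funext i; fin_cases i <;> rfl
  rw [hu, alt_two_apply_eq, h01, h02, h03, h12, h13, h23]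
  simp

/-- **The first-order coefficient does not vanish** when `β₀ ≠ 0` has `(0,1)` and `(v,0)` in
its kernel. [folklore] -/
theorem pfCoeff_ne_zero {β₀ : F4 [⋀^Fin 2]→L[ℝ] ℝ} {v : E3} (hv : v ≠ 0)
    (hk1 : ∀ w, β₀ ![vVec, w] = 0) (hk2 : ∀ w, β₀ ![((v, 0) : F4), w] = 0) (hne : β₀ ≠ 0) :
    pfCoeff β₀ v ≠ 0 := by
  obtain ⟨hbij, h0, h1, h2, h3⟩ := adaptedFrame_spec hv
  set T := adaptedFrame v with hT
  intro hc
  have h01 : β₀ ![T (stdVec 0), T (stdVec 1)] = 0 := by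
    have hd := det_adaptedEndo_ne_zero hv
    rw [pfCoeff, neg_eq_zero, mul_eq_zero] at hc
    rcases hc with hc | hc
    · exact absurd hc (inv_ne_zero hd)
    · exact hc
  -- all six frame entries vanish
  have hk1' : ∀ w, β₀ ![w, vVec] = 0 := fun w => by rw [Kaehler.cam₂_swap, hk1, neg_zero]
  have hk2' : ∀ w, β₀ ![w, ((v, 0) : F4)] = 0 := fun w => by rw [Kaehler.cam₂_swap, hk2, neg_zero]
  have hTval : ∀ i j : Fin 4,
      β₀.compContinuousLinearMap T ![stdVec i, stdVec j] = β₀ ![T (stdVec i), T (stdVec j)] := by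
    intro i j
    rw [ContinuousAlternatingMap.compContinuousLinearMap_apply]
    congr 1
    funext k; fin_cases k <;> rfl
  have hzero : β₀.compContinuousLinearMap T = 0 := by
    apply alt_two_eq_zero_of_stdVec <;> rw [hTval]
    · exact h01
    · rw [h2]; exact hk2' _
    · rw [h3]; exact hk1' _
    · rw [h2]; exact hk2' _
    · rw [h3]; exact hk1' _
    · rw [h2, h3]; exact hk2 _
  apply hne
  ext u
  obtain ⟨a, ha⟩ := hbij.2 (u 0)
  obtain ⟨b, hb⟩ := hbij.2 (u 1)
  have hu : u = (T : E4 → F4) ∘ ![a, b] := by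
    funext k; fin_cases k
    · exact ha.symm
    · exact hb.symm
  rw [hu, ← ContinuousAlternatingMap.compContinuousLinearMap_apply, hzero]
  rfl

/-- **The derivative of the Pfaffian along a curve of `2`-forms through a rank-two form**: if
`C 0` kills `(0,1)` and `(v,0)` (`v ≠ 0`) and `C` has derivative `C'` at `0`, then
`d/dt|₀ pfF (C t) = pfCoeff (C 0) v · C'((0,1),(v,0))` — in the adapted frame five of the six
Pfaffian coefficients vanish at `t = 0`. [cite: CannasGuilleminWoodward2000, proof of Thm. 1] -/
theorem hasDerivAt_pfF_comp {C : ℝ → F4 [⋀^Fin 2]→L[ℝ] ℝ} {C' : F4 [⋀^Fin 2]→L[ℝ] ℝ}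
    (hC : HasDerivAt C C' 0) {v : E3} (hv : v ≠ 0)
    (hk1 : ∀ w, C 0 ![vVec, w] = 0) (hk2 : ∀ w, C 0 ![((v, 0) : F4), w] = 0) :
    HasDerivAt (fun t => pfF (C t)) (pfCoeff (C 0) v * C' ![vVec, ((v, 0) : F4)]) 0 := by
  obtain ⟨hbij, h0, h1, h2, h3⟩ := adaptedFrame_spec hv
  set T := adaptedFrame v with hT
  set d := LinearMap.det (adaptedEndo v : F4 →ₗ[ℝ] F4) with hd
  -- the frame coefficients and their derivatives
  have ha : ∀ i j : Fin 4, HasDerivAt (fun t => C t ![T (stdVec i), T (stdVec j)])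
      (C' ![T (stdVec i), T (stdVec j)]) 0 := fun i j =>
    (ContinuousAlternatingMap.apply ℝ F4 ℝ ![T (stdVec i), T (stdVec j)]).hasFDerivAt.comp_hasDerivAt 0 hC
  have hk1' : ∀ w, C 0 ![w, vVec] = 0 := fun w => by rw [Kaehler.cam₂_swap, hk1, neg_zero]
  have hk2' : ∀ w, C 0 ![w, ((v, 0) : F4)] = 0 := fun w => by rw [Kaehler.cam₂_swap, hk2, neg_zero]
  have z02 : C 0 ![T (stdVec 0), T (stdVec 2)] = 0 := by simp only [h2]; exact hk2' _
  have z12 : C 0 ![T (stdVec 1), T (stdVec 2)] = 0 := by simp only [h2]; exact hk2' _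
  have z03 : C 0 ![T (stdVec 0), T (stdVec 3)] = 0 := by simp only [h3]; exact hk1' _
  have z13 : C 0 ![T (stdVec 1), T (stdVec 3)] = 0 := by simp only [h3]; exact hk1' _
  have z23 : C 0 ![T (stdVec 2), T (stdVec 3)] = 0 := by simp only [h2, h3]; exact hk2 _
  have hP := hasDerivAt_pfaffCombination (ha 0 1) (ha 0 2) (ha 0 3) (ha 1 2) (ha 1 3) (ha 2 3)
    z02 z12 z03 z13 z23
  -- `pfF (C t) = d⁻¹ · P t`
  have heq : (fun t => pfF (C t)) = fun t => d⁻¹ *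
      (C t ![T (stdVec 0), T (stdVec 1)] * C t ![T (stdVec 2), T (stdVec 3)] -
        C t ![T (stdVec 0), T (stdVec 2)] * C t ![T (stdVec 1), T (stdVec 3)] +
        C t ![T (stdVec 0), T (stdVec 3)] * C t ![T (stdVec 1), T (stdVec 2)]) := by
    funext t
    exact pfF_eq_frame (C t) hv
  rw [heq]
  refine (hP.const_mul d⁻¹).congr_deriv ?_
  have hd' : C' ![T (stdVec 2), T (stdVec 3)] = -C' ![vVec, ((v, 0) : F4)] := by
    simp only [h2, h3]
    exact Kaehler.cam₂_swap C' _ _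
  rw [hd', pfCoeff]
  ring

/-- **Along the Moser segment the Pfaffian keeps a simple zero.** For two curves `C₀, C₁` of
`2`-forms with the same rank-two value at `0` (kernel spanned by `(0,1)`, `(v,0)`) and with
first-order coefficients `C₀'((0,1),(v,0))`, `C₁'((0,1),(v,0))` both positive, every form of the
segment `C₀ + s (C₁ - C₀)`, `s ∈ [0, 1]`, has `d/dt|₀ pfF ≠ 0`.
[cite: CannasGuilleminWoodward2000, proof of Thm. 1] -/
theorem deriv_pfF_segment_ne_zero {C₀ C₁ : ℝ → F4 [⋀^Fin 2]→L[ℝ] ℝ}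
    {C₀' C₁' : F4 [⋀^Fin 2]→L[ℝ] ℝ} (hC₀ : HasDerivAt C₀ C₀' 0) (hC₁ : HasDerivAt C₁ C₁' 0)
    (h01 : C₁ 0 = C₀ 0) {v : E3} (hv : v ≠ 0)
    (hk1 : ∀ w, C₀ 0 ![vVec, w] = 0) (hk2 : ∀ w, C₀ 0 ![((v, 0) : F4), w] = 0) (hne : C₀ 0 ≠ 0)
    (hpos₀ : 0 < C₀' ![vVec, ((v, 0) : F4)]) (hpos₁ : 0 < C₁' ![vVec, ((v, 0) : F4)])
    {s : ℝ} (hs : s ∈ Icc (0 : ℝ) 1) :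
    deriv (fun t => pfF (C₀ t + s • (C₁ t - C₀ t))) 0 ≠ 0 := by
  have hC : HasDerivAt (fun t => C₀ t + s • (C₁ t - C₀ t)) (C₀' + s • (C₁' - C₀')) 0 :=
    hC₀.add ((hC₁.sub hC₀).const_smul s)
  have h0 : C₀ 0 + s • (C₁ 0 - C₀ 0) = C₀ 0 := by rw [h01, sub_self, smul_zero, add_zero]
  have hk1s : ∀ w, (C₀ 0 + s • (C₁ 0 - C₀ 0)) ![vVec, w] = 0 := by rw [h0]; exact hk1
  have hk2s : ∀ w, (C₀ 0 + s • (C₁ 0 - C₀ 0)) ![((v, 0) : F4), w] = 0 := by rw [h0]; exact hk2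
  have hD := hasDerivAt_pfF_comp hC hv hk1s hk2s
  rw [hD.deriv, h0]
  refine mul_ne_zero (pfCoeff_ne_zero hv hk1 hk2 hne) ?_
  have hval : (C₀' + s • (C₁' - C₀')) ![vVec, ((v, 0) : F4)] =
      (1 - s) * C₀' ![vVec, ((v, 0) : F4)] + s * C₁' ![vVec, ((v, 0) : F4)] := by
    simp only [ContinuousAlternatingMap.add_apply, ContinuousAlternatingMap.smul_apply,
      ContinuousAlternatingMap.sub_apply, smul_eq_mul]
    ring
  rw [hval]
  apply ne_of_gt
  rcases eq_or_lt_of_le hs.2 with h | h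
  · subst h
    simpa using hpos₁
  · have h1 : 0 < (1 - s) * C₀' ![vVec, ((v, 0) : F4)] := mul_pos (by linarith) hpos₀
    have h2 : 0 ≤ s * C₁' ![vVec, ((v, 0) : F4)] := mul_nonneg hs.1 hpos₁.le
    linarith

end OrigamiMoser

end Literature.Geometry.Symplectic

end
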